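import Summits.AtomisticToContinuum.HydrodynamicLimit.Theorems.RelayRaceLocalityNearConstantShortTimeHLDensityLDNetDefs
import Summits.AtomisticToContinuum.HydrodynamicLimit.Theorems.RelayRaceLocalityNearConstantShortTimeHLDensityLDTerm
import Summits.AtomisticToContinuum.HydrodynamicLimit.Theorems.RelayRaceLocalityNearConstantShortTimeHLDensityLDGrid
import Summits.AtomisticToContinuum.HydrodynamicLimit.Theorems.RelayRaceLocalityNearConstantShortTimeHLCellsJensen
import Summits.AtomisticToContinuum.HydrodynamicLimit.Theorems.RelayRaceLocalityNearConstantShortTimeHLBallKernelSchur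
import Summits.AtomisticToContinuum.HydrodynamicLimit.Theorems.RelayRaceLocalityNearConstantShortTimeHLNetExpansion
import Literature.MathematicalPhysics.KineticTheory.HardSphereUniformGasShift
import HarnessLib

/-!
# Crux `NearConstantShortTimeHL` (stmt-AtomisticToContinuum-12502), line `small-tilt-domination`, skeleton v14 (lead c7):
# registered stub `stub_densityLD_of_ballTilt : BallTiltLogLaplace → MesoscaleDensityLD` (the NET REDUCTION)

Support file (`--supports stmt-AtomisticToContinuum-12502`) proving the registered skeleton stub `stub_densityLD_of_ballTilt`:
the mesoscale DENSITY large deviation of the canonical dilute hard-sphere gas (`MesoscaleDensityLD`, the statics residue of the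
line) from the log-Laplace bound for ball-average LINEAR statistics (`BallTiltLogLaplace`, `…DensityLDNetDefs`). Blueprint
(`…DensityLDNetDefs` module doc): (1) weight removal on the hard-core support (`pd_ballAvg_le`: `ρ̃ ≤ 32/σ³`); (2) Jensen over the
`k³` torus cells, `k = ⌈10/ℓ⌉` (`cells_jensen`); (3) the quadratic net of resolution `q(κ)` (`exp_sum_min_one_sq_le_net_sum`);
(4) Tonelli and, for each net assignment and each cell selection, the per-term estimate `dl_term_le` fed by the instance of
`BallTiltLogLaplace` at tilt strength `4γ′`, the Schur bound `integral_sq_sum_ballKernel_le` and the envelope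
`Σ_j k⁻³ ballKernel ℓ (y_j) · ≤ 2` (`cells_meeting_ball_card_le`); (5) counting: `(k³)^{k³}` from Jensen cancels against the mass of
the product of the cell measures, the net has `(4q+1)^{k³} ≤ e^{κ n/6}` points (`k³ ≤ 1331 n ℓ`), the net slack is `γ′ n/(4q²) ≤ κ n/6`,
the Lipschitz bias `2γ′ M ℓ n ≤ κ n/6`. Exponent `γ = γ′/(1 + 32/σ³)`, `γ′ = min(γ₁/4, 1/(8 C₀))`.
References: H.-T. Yau, Lett. Math. Phys. 22 (1991) §2; C. Kipnis – C. Landim (1999) App. 2 §3 (folklore reduction).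
-/

noncomputable section

namespace Summit.AtomisticToContinuum.HydrodynamicLimit.Theorems.NearConstantShortTimeHL

open scoped BigOperators ENNReal
open MeasureTheory Set Filter Topology
open Literature.MathematicalPhysics.KineticTheory Literature.Analysis.FluidPDE Literature.Analysis.FunctionSpaces

/-! ## The core estimate at fixed data -/

/-- **The chain at fixed data** (steps 1–5 of the blueprint for one `N` and one profile): weight removal on the support, Jensen over
the cells, the net, Tonelli, the per-term estimate, and the bookkeeping of the constants — everything except the choice of the
constants and the passage to `N → ∞`. The log-Laplace input is the hypothesis `hB` (the instance of `BallTiltLogLaplace` at tilt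
strength `4γ′`). [cite: Yau1991, §2] -/
theorem dn_core {σ : ℝ} (hσ : 0 < σ) {m : ℕ} (hm : 0 < m) {ε ℓ : ℝ} (hε : 0 < ε) (hℓ0 : 0 < ℓ) (hεℓ : ε ≤ 2 * ℓ)
    (h13 : 13 * ℓ < 1 / 2) (hmε : σ ^ 3 / 2 ≤ (m : ℝ) * ε ^ 3) (a : T3 → ℝ) {ρ₁ : T3 → ℝ} (hρc : Continuous ρ₁)
    {M : ℝ} (hM : 0 ≤ M) (hlip : ∀ x y, |ρ₁ x - ρ₁ y| ≤ M * dist x y)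
    {k : ℕ} (hk0 : 0 < k) (hkℓ : 10 ≤ (k : ℝ) * ℓ) (hk2 : ℓ + 2 / k < 1 / 2) {q : ℕ} (hq0 : 0 < q)
    {γ' C₀ κ₂ : ℝ} (hγ'0 : 0 < γ') (hγ'C : C₀ * γ' * 2 ≤ 1 / 4)
    (hB : ∀ (J : ℕ) (y : Fin J → T3) (w : Fin J → ℝ), (∀ x : T3, |∑ j, w j * ballKernel ℓ (y j) x| ≤ 1) →
      ∫⁻ x, ENNReal.ofReal (Real.exp ((4 * γ') * ∑ i, ∑ j, w j * ballKernel ℓ (y j) (x i))) ∂posGibbsMeasure a ε m ≤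
        ENNReal.ofReal (Real.exp ((m : ℝ) * ((4 * γ') * (∫ x, (∑ j, w j * ballKernel ℓ (y j) x) * ρ₁ x) +
          C₀ * (4 * γ') ^ 2 * (∫ x, (∑ j, w j * ballKernel ℓ (y j) x) ^ 2) + κ₂)))) :
    ∫⁻ x, ENNReal.ofReal (Real.exp (γ' / (1 + 32 / σ ^ 3) * (m : ℝ) *
        ∫ y, (1 + (m : ℝ)⁻¹ * ∑ i, ballKernel ℓ y (x i)) * min 1 (((m : ℝ)⁻¹ * ∑ i, ballKernel ℓ y (x i) - ρ₁ y) ^ 2)))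
        ∂posGibbsMeasure a ε m ≤
      ENNReal.ofReal (Real.exp (γ' * (m : ℝ) / (4 * (q : ℝ) ^ 2))) *
        ((((4 * q + 1) ^ (k ^ 3) : ℕ) : ℝ≥0∞) * ENNReal.ofReal (Real.exp ((m : ℝ) * (2 * γ' * M * ℓ + κ₂)))) := by
  have hm' : (0 : ℝ) < m := Nat.cast_pos.2 hm
  have hmne : (m : ℝ) ≠ 0 := hm'.ne'
  have hhalf : ℓ < 1 / 2 := by linarith
  have hhalfε : ℓ + ε / 2 < 1 / 2 := by linarith
  have hq' : (0 : ℝ) < q := Nat.cast_pos.2 hq0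
  have hP0 : (0 : ℝ) < 32 / σ ^ 3 := by positivity
  have hb0 : (0 : ℝ) ≤ ((k : ℝ) ^ 3)⁻¹ := by positivity
  have hcardJ : Fintype.card (Fin 3 → Fin k) = k ^ 3 := by
    rw [Fintype.card_fun, Fintype.card_fin, Fintype.card_fin]
  have hbsum : ∑ _j : Fin 3 → Fin k, ((k : ℝ) ^ 3)⁻¹ = 1 := by
    rw [Finset.sum_const, Finset.card_univ, hcardJ, nsmul_eq_mul]
    push_cast
    exact mul_inv_cancel₀ (by positivity)
  have hc0 : 0 ≤ γ' * (m : ℝ) := by positivity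
  -- the product of the cell measures (generalised, to keep definitional unfolding out of the way)
  obtain ⟨Pc, hPc⟩ : ∃ Pc : Measure ((Fin 3 → Fin k) → T3), Pc = Measure.pi fun j : Fin 3 → Fin k =>
      (volume : Measure T3).restrict {y : T3 | Torus.gridIndex k (Torus.repr y) = Torus.finIndex j} := ⟨_, rfl⟩
  -- the capped squared deviation (generalised likewise)
  obtain ⟨F, hF⟩ : ∃ F : (Fin m → T3) → T3 → ℝ,
      F = fun x y => min 1 (((m : ℝ)⁻¹ * ∑ i, ballKernel ℓ y (x i) - ρ₁ y) ^ 2) := ⟨_, rfl⟩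
  have hF0 : ∀ x y, 0 ≤ F x y := fun x y => by rw [hF]; exact le_min zero_le_one (sq_nonneg _)
  have hF1 : ∀ x y, F x y ≤ 1 := fun x y => by rw [hF]; exact min_le_left _ _
  have hFm : Measurable fun p : (Fin m → T3) × T3 => F p.1 p.2 := by
    rw [hF]; exact dn_measurable_capped ℓ hρc.measurable
  have hFxm : ∀ x, Measurable (F x) := fun x => hFm.comp (measurable_const.prodMk measurable_id)
  have hdevm : Measurable fun p : (Fin m → T3) × T3 => (m : ℝ)⁻¹ * ∑ i, ballKernel ℓ p.2 (p.1 i) - ρ₁ p.2 :=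
    dn_measurable_dev ℓ hρc.measurable
  -- a.e. under the configurational Gibbs measure the spheres do not overlap
  have hae : ∀ᵐ x ∂posGibbsMeasure a ε m, x ∈ posDomain ε m := ae_mem_posDomain a ε m
  -- STEP 1: weight removal on the support
  have hstep1 : ∀ᵐ x ∂posGibbsMeasure a ε m,
      ENNReal.ofReal (Real.exp (γ' / (1 + 32 / σ ^ 3) * (m : ℝ) *
        ∫ y, (1 + (m : ℝ)⁻¹ * ∑ i, ballKernel ℓ y (x i)) * min 1 (((m : ℝ)⁻¹ * ∑ i, ballKernel ℓ y (x i) - ρ₁ y) ^ 2))) ≤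
      ENNReal.ofReal (Real.exp (γ' * (m : ℝ) * ∫ y, F x y)) := by
    filter_upwards [hae] with x hx
    refine ENNReal.ofReal_le_ofReal (Real.exp_le_exp.2 ?_)
    have hρt0 : ∀ y, 0 ≤ (m : ℝ)⁻¹ * ∑ i, ballKernel ℓ y (x i) := fun y =>
      mul_nonneg (inv_nonneg.2 (Nat.cast_nonneg _)) (Finset.sum_nonneg fun i _ => ballKernel_nonneg ℓ y (x i))
    have hρtP : ∀ y, (m : ℝ)⁻¹ * ∑ i, ballKernel ℓ y (x i) ≤ 32 / σ ^ 3 := fun y =>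
      pd_ballAvg_le hσ hm hε hℓ0 hεℓ hhalfε hmε hx y
    have hFi : Integrable (F x) := by
      refine (integrable_const (1 : ℝ)).mono' (hFxm x).aestronglyMeasurable (Eventually.of_forall fun y => ?_)
      rw [Real.norm_of_nonneg (hF0 x y)]; exact hF1 x y
    have hle : ∫ y, (1 + (m : ℝ)⁻¹ * ∑ i, ballKernel ℓ y (x i)) * min 1 (((m : ℝ)⁻¹ * ∑ i, ballKernel ℓ y (x i) - ρ₁ y) ^ 2) ≤
        ∫ y, (1 + 32 / σ ^ 3) * F x y := by
      refine integral_mono_of_nonneg (Eventually.of_forall fun y => ?_) (hFi.const_mul _)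
        (Eventually.of_forall fun y => ?_)
      · exact mul_nonneg (by linarith [hρt0 y]) (le_min zero_le_one (sq_nonneg _))
      · have hFy : F x y = min 1 (((m : ℝ)⁻¹ * ∑ i, ballKernel ℓ y (x i) - ρ₁ y) ^ 2) := by rw [hF]
        beta_reduce
        rw [hFy]
        exact mul_le_mul_of_nonneg_right (by linarith [hρtP y]) (le_min zero_le_one (sq_nonneg _))
    rw [integral_const_mul] at hle
    calc γ' / (1 + 32 / σ ^ 3) * (m : ℝ) * ∫ y, (1 + (m : ℝ)⁻¹ * ∑ i, ballKernel ℓ y (x i)) *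
          min 1 (((m : ℝ)⁻¹ * ∑ i, ballKernel ℓ y (x i) - ρ₁ y) ^ 2)
        ≤ γ' / (1 + 32 / σ ^ 3) * (m : ℝ) * ((1 + 32 / σ ^ 3) * ∫ y, F x y) :=
          mul_le_mul_of_nonneg_left hle (by positivity)
      _ = γ' * (m : ℝ) * ∫ y, F x y := by field_simp
  -- STEP 2: Jensen over the cells, pointwise in `x`
  have hstep2 : ∀ x : Fin m → T3, ENNReal.ofReal (Real.exp (γ' * (m : ℝ) * ∫ y, F x y)) ≤
      ((k : ℝ≥0∞) ^ 3) ^ (k ^ 3) *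
        ∫⁻ ys, ENNReal.ofReal (Real.exp (γ' * (m : ℝ) * ((k : ℝ) ^ 3)⁻¹ * ∑ j, F x (ys j))) ∂Pc := by
    intro x
    rw [hPc]
    exact cells_jensen hk0 (hFxm x) ⟨1, fun y => by rw [abs_of_nonneg (hF0 x y)]; exact hF1 x y⟩ hc0
  -- STEP 3: the net, pointwise in `(x, ys)`
  have hlam2 : ∀ (s : (Fin 3 → Fin k) → Fin (4 * q + 1)) j, |(((s j : ℕ) : ℝ) / q - 2)| ≤ 2 := by
    intro s j
    have h0 : (0 : ℝ) ≤ ((s j : ℕ) : ℝ) := Nat.cast_nonneg _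
    have h4 : ((s j : ℕ) : ℝ) ≤ 4 * q := by
      have h' : (s j : ℕ) ≤ 4 * q := Nat.lt_succ_iff.1 (s j).isLt
      exact_mod_cast h'
    rw [abs_le]
    constructor
    · have : 0 ≤ ((s j : ℕ) : ℝ) / q := by positivity
      linarith
    · have : ((s j : ℕ) : ℝ) / q ≤ 4 := by rw [div_le_iff₀ hq']; linarith
      linarith
  have hstep3 : ∀ (x : Fin m → T3) (ys : (Fin 3 → Fin k) → T3),
      ENNReal.ofReal (Real.exp (γ' * (m : ℝ) * ((k : ℝ) ^ 3)⁻¹ * ∑ j, F x (ys j))) ≤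
      ENNReal.ofReal (Real.exp (γ' * (m : ℝ) / (4 * (q : ℝ) ^ 2))) *
        ∑ s : (Fin 3 → Fin k) → Fin (4 * q + 1), ENNReal.ofReal (Real.exp (γ' * (m : ℝ) *
          ∑ j, ((k : ℝ) ^ 3)⁻¹ * ((((s j : ℕ) : ℝ) / q - 2) * (((m : ℝ)⁻¹ * ∑ i, ballKernel ℓ (ys j) (x i)) - ρ₁ (ys j)) -
            (((s j : ℕ) : ℝ) / q - 2) ^ 2 / 4))) := by
    intro x ys
    have h := exp_sum_min_one_sq_le_net_sum hq0 (J := Fin 3 → Fin k) (fun _ => ((k : ℝ) ^ 3)⁻¹)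
      (fun j => ((m : ℝ)⁻¹ * ∑ i, ballKernel ℓ (ys j) (x i)) - ρ₁ (ys j)) (fun _ => hb0) hc0
    rw [hbsum, mul_one] at h
    have e : γ' * (m : ℝ) * ((k : ℝ) ^ 3)⁻¹ * ∑ j, F x (ys j) =
        γ' * (m : ℝ) * ∑ j, ((k : ℝ) ^ 3)⁻¹ * min 1 ((((m : ℝ)⁻¹ * ∑ i, ballKernel ℓ (ys j) (x i)) - ρ₁ (ys j)) ^ 2) := by
      rw [mul_assoc, Finset.mul_sum, hF]
    rw [e, ← ENNReal.ofReal_sum_of_nonneg (fun s _ => Real.exp_nonneg _), ← ENNReal.ofReal_mul (Real.exp_nonneg _)]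
    exact ENNReal.ofReal_le_ofReal h
  -- STEP 4: the per-term estimate, for selections in the cells
  have hterm : ∀ ys : (Fin 3 → Fin k) → T3, (∀ j, Torus.gridIndex k (Torus.repr (ys j)) = Torus.finIndex j) →
      ∀ s : (Fin 3 → Fin k) → Fin (4 * q + 1), ∫⁻ x, ENNReal.ofReal (Real.exp (γ' * (m : ℝ) *
          ∑ j, ((k : ℝ) ^ 3)⁻¹ * ((((s j : ℕ) : ℝ) / q - 2) * (((m : ℝ)⁻¹ * ∑ i, ballKernel ℓ (ys j) (x i)) - ρ₁ (ys j)) -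
            (((s j : ℕ) : ℝ) / q - 2) ^ 2 / 4))) ∂posGibbsMeasure a ε m ≤
        ENNReal.ofReal (Real.exp ((m : ℝ) * (2 * γ' * M * ℓ + κ₂))) := by
    intro ys hys s
    have henv : ∀ x, ∑ j, ((k : ℝ) ^ 3)⁻¹ * ballKernel ℓ (ys j) x ≤ 2 := fun x => dn_envelope hk0 hℓ0 hkℓ hk2 ys hys x
    -- transport the `Fin (k³)`-indexed tree statements to the cell index
    let e : (Fin 3 → Fin k) ≃ Fin (Fintype.card (Fin 3 → Fin k)) := Fintype.equivFin _
    have hSchur : ∀ lam' : (Fin 3 → Fin k) → ℝ,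
        ∫ x, (∑ j, ((k : ℝ) ^ 3)⁻¹ / 4 * lam' j * ballKernel ℓ (ys j) x) ^ 2 ≤
          2 / 4 * ∑ j, ((k : ℝ) ^ 3)⁻¹ / 4 * lam' j ^ 2 := by
      intro lam'
      have henv' : ∀ x : T3, ∑ j, ((k : ℝ) ^ 3)⁻¹ / 4 * ballKernel ℓ ((ys ∘ e.symm) j) x ≤ 2 / 4 := by
        intro x
        simp only [Function.comp_apply]
        rw [e.symm.sum_comp (fun j => ((k : ℝ) ^ 3)⁻¹ / 4 * ballKernel ℓ (ys j) x)]
        calc ∑ j, ((k : ℝ) ^ 3)⁻¹ / 4 * ballKernel ℓ (ys j) x = (1 / 4) * ∑ j, ((k : ℝ) ^ 3)⁻¹ * ballKernel ℓ (ys j) x := by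
              rw [Finset.mul_sum]; exact Finset.sum_congr rfl fun j _ => by ring
          _ ≤ (1 / 4) * 2 := mul_le_mul_of_nonneg_left (henv x) (by norm_num)
          _ = 2 / 4 := by norm_num
      have h := integral_sq_sum_ballKernel_le hℓ0 hhalf (ys ∘ e.symm) (fun _ => ((k : ℝ) ^ 3)⁻¹ / 4) (lam' ∘ e.symm)
        (A := 2 / 4) (fun _ => by positivity) henv'
      have e1 : (fun x => (∑ j, ((k : ℝ) ^ 3)⁻¹ / 4 * (lam' ∘ e.symm) j * ballKernel ℓ ((ys ∘ e.symm) j) x) ^ 2) =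
          fun x => (∑ j, ((k : ℝ) ^ 3)⁻¹ / 4 * lam' j * ballKernel ℓ (ys j) x) ^ 2 := by
        funext x
        simp only [Function.comp_apply]
        rw [e.symm.sum_comp (fun j => ((k : ℝ) ^ 3)⁻¹ / 4 * lam' j * ballKernel ℓ (ys j) x)]
      have e2 : ∑ j, ((k : ℝ) ^ 3)⁻¹ / 4 * (lam' ∘ e.symm) j ^ 2 = ∑ j, ((k : ℝ) ^ 3)⁻¹ / 4 * lam' j ^ 2 := by
        simp only [Function.comp_apply]
        exact e.symm.sum_comp (fun j => ((k : ℝ) ^ 3)⁻¹ / 4 * lam' j ^ 2)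
      rw [e1, e2] at h
      exact h
    have hBys : ∀ w : (Fin 3 → Fin k) → ℝ, (∀ x, |∑ j, w j * ballKernel ℓ (ys j) x| ≤ 1) →
        ∫⁻ x, ENNReal.ofReal (Real.exp ((4 * γ') * ∑ i, ∑ j, w j * ballKernel ℓ (ys j) (x i)))
            ∂posGibbsMeasure a ε m ≤
          ENNReal.ofReal (Real.exp ((m : ℝ) * ((4 * γ') * (∫ x, (∑ j, w j * ballKernel ℓ (ys j) x) * ρ₁ x) +
            C₀ * (4 * γ') ^ 2 * (∫ x, (∑ j, w j * ballKernel ℓ (ys j) x) ^ 2) + κ₂))) := by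
      intro w hw
      have h := hB (Fintype.card (Fin 3 → Fin k)) (ys ∘ e.symm) (w ∘ e.symm)
      have e1 : ∀ x : T3, ∑ j, (w ∘ e.symm) j * ballKernel ℓ ((ys ∘ e.symm) j) x = ∑ j, w j * ballKernel ℓ (ys j) x := by
        intro x
        simp only [Function.comp_apply]
        exact e.symm.sum_comp (fun j => w j * ballKernel ℓ (ys j) x)
      simp only [e1] at h
      exact h hw
    exact dl_term_le hm hℓ0 hhalf (posGibbsMeasure a ε m) hρc hM hlip ys hb0 hbsum henv le_rfl
      hγ'0 hγ'C hSchur hBys (fun j => (((s j : ℕ) : ℝ) / q - 2)) (hlam2 s)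
  -- STEP 5: assembly
  have hKPc : ((k : ℝ≥0∞) ^ 3) ^ (k ^ 3) * Pc univ = 1 := by
    rw [hPc, dn_pi_univ hk0, ← mul_pow, ← mul_pow,
      ENNReal.mul_inv_cancel (by exact_mod_cast hk0.ne') (ENNReal.natCast_ne_top k), one_pow, one_pow]
  have hPcae : ∀ᵐ ys ∂Pc, ∀ j, Torus.gridIndex k (Torus.repr (ys j)) = Torus.finIndex j := by
    rw [hPc]; exact dn_pi_ae_mem hk0
  haveI : SFinite Pc := by rw [hPc]; infer_instance
  haveI : SFinite (posGibbsMeasure a ε m) := by unfold posGibbsMeasure; infer_instance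
  have hQm : ∀ (s : (Fin 3 → Fin k) → Fin (4 * q + 1)) (ys : (Fin 3 → Fin k) → T3),
      Measurable fun x : Fin m → T3 => ENNReal.ofReal (Real.exp (γ' * (m : ℝ) *
        ∑ j, ((k : ℝ) ^ 3)⁻¹ * ((((s j : ℕ) : ℝ) / q - 2) * (((m : ℝ)⁻¹ * ∑ i, ballKernel ℓ (ys j) (x i)) - ρ₁ (ys j)) -
          (((s j : ℕ) : ℝ) / q - 2) ^ 2 / 4))) := by
    intro s ys
    refine (Measurable.exp (measurable_const.mul (Finset.measurable_sum _ fun j _ => ?_))).ennreal_ofReal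
    exact measurable_const.mul (((measurable_const.mul
      (hdevm.comp (measurable_id.prodMk measurable_const))).sub measurable_const))
  have hswap_m : AEMeasurable (Function.uncurry fun (x : Fin m → T3) (ys : (Fin 3 → Fin k) → T3) =>
      ENNReal.ofReal (Real.exp (γ' * (m : ℝ) * ((k : ℝ) ^ 3)⁻¹ * ∑ j, F x (ys j))))
      ((posGibbsMeasure a ε m).prod Pc) := by
    refine (Measurable.exp (measurable_const.mul (Finset.measurable_sum _ fun j _ => ?_))).ennreal_ofReal.aemeasurable
    exact hFm.comp (measurable_fst.prodMk ((measurable_pi_apply j).comp measurable_snd))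
  have hinner : ∀ᵐ ys ∂Pc, ∫⁻ x, ENNReal.ofReal (Real.exp (γ' * (m : ℝ) * ((k : ℝ) ^ 3)⁻¹ * ∑ j, F x (ys j)))
      ∂posGibbsMeasure a ε m ≤
      ENNReal.ofReal (Real.exp (γ' * (m : ℝ) / (4 * (q : ℝ) ^ 2))) *
        ((Fintype.card ((Fin 3 → Fin k) → Fin (4 * q + 1)) : ℝ≥0∞) *
          ENNReal.ofReal (Real.exp ((m : ℝ) * (2 * γ' * M * ℓ + κ₂)))) := by
    filter_upwards [hPcae] with ys hys
    calc ∫⁻ x, ENNReal.ofReal (Real.exp (γ' * (m : ℝ) * ((k : ℝ) ^ 3)⁻¹ * ∑ j, F x (ys j))) ∂posGibbsMeasure a ε m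
        ≤ ∫⁻ x, ENNReal.ofReal (Real.exp (γ' * (m : ℝ) / (4 * (q : ℝ) ^ 2))) *
            ∑ s : (Fin 3 → Fin k) → Fin (4 * q + 1), ENNReal.ofReal (Real.exp (γ' * (m : ℝ) *
              ∑ j, ((k : ℝ) ^ 3)⁻¹ * ((((s j : ℕ) : ℝ) / q - 2) * (((m : ℝ)⁻¹ * ∑ i, ballKernel ℓ (ys j) (x i)) - ρ₁ (ys j)) -
                (((s j : ℕ) : ℝ) / q - 2) ^ 2 / 4))) ∂posGibbsMeasure a ε m :=
          lintegral_mono fun x => hstep3 x ys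
      _ = ENNReal.ofReal (Real.exp (γ' * (m : ℝ) / (4 * (q : ℝ) ^ 2))) *
            ∑ s : (Fin 3 → Fin k) → Fin (4 * q + 1), ∫⁻ x, ENNReal.ofReal (Real.exp (γ' * (m : ℝ) *
              ∑ j, ((k : ℝ) ^ 3)⁻¹ * ((((s j : ℕ) : ℝ) / q - 2) * (((m : ℝ)⁻¹ * ∑ i, ballKernel ℓ (ys j) (x i)) - ρ₁ (ys j)) -
                (((s j : ℕ) : ℝ) / q - 2) ^ 2 / 4))) ∂posGibbsMeasure a ε m := by
          rw [lintegral_const_mul' _ _ ENNReal.ofReal_ne_top, lintegral_finsetSum _ fun s _ => hQm s ys]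
      _ ≤ ENNReal.ofReal (Real.exp (γ' * (m : ℝ) / (4 * (q : ℝ) ^ 2))) *
            ∑ _s : (Fin 3 → Fin k) → Fin (4 * q + 1), ENNReal.ofReal (Real.exp ((m : ℝ) * (2 * γ' * M * ℓ + κ₂))) := by
          gcongr with s
          exact hterm ys hys s
      _ = ENNReal.ofReal (Real.exp (γ' * (m : ℝ) / (4 * (q : ℝ) ^ 2))) *
            ((Fintype.card ((Fin 3 → Fin k) → Fin (4 * q + 1)) : ℝ≥0∞) *
              ENNReal.ofReal (Real.exp ((m : ℝ) * (2 * γ' * M * ℓ + κ₂)))) := by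
          rw [Finset.sum_const, Finset.card_univ, nsmul_eq_mul]
  -- the chain
  calc ∫⁻ x, ENNReal.ofReal (Real.exp (γ' / (1 + 32 / σ ^ 3) * (m : ℝ) *
          ∫ y, (1 + (m : ℝ)⁻¹ * ∑ i, ballKernel ℓ y (x i)) * min 1 (((m : ℝ)⁻¹ * ∑ i, ballKernel ℓ y (x i) - ρ₁ y) ^ 2)))
          ∂posGibbsMeasure a ε m
      ≤ ∫⁻ x, ENNReal.ofReal (Real.exp (γ' * (m : ℝ) * ∫ y, F x y)) ∂posGibbsMeasure a ε m := lintegral_mono_ae hstep1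
    _ ≤ ∫⁻ x, ((k : ℝ≥0∞) ^ 3) ^ (k ^ 3) *
          ∫⁻ ys, ENNReal.ofReal (Real.exp (γ' * (m : ℝ) * ((k : ℝ) ^ 3)⁻¹ * ∑ j, F x (ys j))) ∂Pc
          ∂posGibbsMeasure a ε m := lintegral_mono fun x => hstep2 x
    _ = ((k : ℝ≥0∞) ^ 3) ^ (k ^ 3) * ∫⁻ ys, ∫⁻ x,
          ENNReal.ofReal (Real.exp (γ' * (m : ℝ) * ((k : ℝ) ^ 3)⁻¹ * ∑ j, F x (ys j))) ∂posGibbsMeasure a ε m ∂Pc := by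
        rw [lintegral_const_mul' _ _ (by simp), lintegral_lintegral_swap hswap_m]
    _ ≤ ((k : ℝ≥0∞) ^ 3) ^ (k ^ 3) * ∫⁻ _ys, ENNReal.ofReal (Real.exp (γ' * (m : ℝ) / (4 * (q : ℝ) ^ 2))) *
          ((Fintype.card ((Fin 3 → Fin k) → Fin (4 * q + 1)) : ℝ≥0∞) *
            ENNReal.ofReal (Real.exp ((m : ℝ) * (2 * γ' * M * ℓ + κ₂)))) ∂Pc := by
        gcongr 1
        exact lintegral_mono_ae hinner
    _ = (((k : ℝ≥0∞) ^ 3) ^ (k ^ 3) * Pc univ) * (ENNReal.ofReal (Real.exp (γ' * (m : ℝ) / (4 * (q : ℝ) ^ 2))) *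
          ((Fintype.card ((Fin 3 → Fin k) → Fin (4 * q + 1)) : ℝ≥0∞) *
            ENNReal.ofReal (Real.exp ((m : ℝ) * (2 * γ' * M * ℓ + κ₂))))) := by
        rw [lintegral_const]; ring
    _ = ENNReal.ofReal (Real.exp (γ' * (m : ℝ) / (4 * (q : ℝ) ^ 2))) *
          ((((4 * q + 1) ^ (k ^ 3) : ℕ) : ℝ≥0∞) * ENNReal.ofReal (Real.exp ((m : ℝ) * (2 * γ' * M * ℓ + κ₂)))) := by
        rw [hKPc, one_mul, Fintype.card_fun, Fintype.card_fin, hcardJ]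

/-! ## The reduction -/

/-- **`MesoscaleDensityLD` from the log-Laplace bound for ball-average tilts** (registered skeleton stub of v14; the net reduction
of `…DensityLDNetDefs`). [cite: Yau1991, §2] -/
theorem stub_densityLD_of_ballTilt : BallTiltLogLaplace → MesoscaleDensityLD := by
  intro hBall
  obtain ⟨η₁, hη₁, hBall⟩ := hBall
  refine ⟨η₁, hη₁, ?_⟩
  intro M hM σ hσ g ε n hε hε0 hnε
  obtain ⟨C₀, hC₀, γ₁, hγ₁, hB⟩ := hBall M hM σ hσ ε n hε hε0 hnε
  have hM0 : 0 < M := one_pos.trans_le hM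
  -- constants
  set γ' : ℝ := min (γ₁ / 4) (1 / (8 * C₀)) with hγ'_def
  have hγ'0 : 0 < γ' := lt_min (by positivity) (by positivity)
  have hγ'1 : 4 * γ' ≤ γ₁ := by linarith [min_le_left (γ₁ / 4) (1 / (8 * C₀))]
  have hγ'C : C₀ * γ' * 2 ≤ 1 / 4 := by
    have h : γ' ≤ 1 / (8 * C₀) := min_le_right _ _
    rw [le_div_iff₀ (by positivity)] at h
    linarith
  refine ⟨0, γ' / (1 + 32 / σ ^ 3), div_pos hγ'0 (by positivity), fun κ hκ => ?_⟩
  -- the net resolution `q` (fixed before `N`)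
  set q : ℕ := ⌈3 * γ' / (2 * κ)⌉₊ + 1 with hq_def
  have hq0 : 0 < q := Nat.succ_pos _
  have hq' : (0 : ℝ) < q := Nat.cast_pos.2 hq0
  have hqκ : γ' / (4 * (q : ℝ) ^ 2) ≤ κ / 6 := by
    have h1 : 3 * γ' / (2 * κ) ≤ q := by
      rw [hq_def]; push_cast
      linarith [Nat.le_ceil (3 * γ' / (2 * κ))]
    have h2 : (q : ℝ) ≤ (q : ℝ) ^ 2 := by
      have : (1 : ℝ) ≤ q := by exact_mod_cast hq0
      nlinarith
    rw [div_le_iff₀ (by positivity)]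
    rw [div_le_iff₀ (by positivity)] at h1
    nlinarith
  have hlog0 : 0 < Real.log (4 * (q : ℝ) + 1) := Real.log_pos (by linarith)
  -- eventually in `N`
  filter_upwards [hB (4 * γ') (by positivity) hγ'1 (κ / 6) (by positivity),
    dn_eventually hσ hε hε0 hnε (2 * γ' * M) (1331 * Real.log (4 * q + 1)) hκ] with N hBN hEN
  obtain ⟨hn0, hℓ0, hℓ1, hεℓ, h13, hmε, hℓ4, hbias, hcount⟩ := hEN
  intro ρ₁ θ₁ u₁ hρc _ _ hρ1 hbox hlip
  have hBρ := hBN ρ₁ hρc hρ1 (fun x => ⟨(hbox x).1, (hbox x).2.1⟩) (fun x y => (hlip x y).1)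
  clear hBN hB
  have hm' : (0 : ℝ) < n N := Nat.cast_pos.2 hn0
  have hmne : ((n N : ℕ) : ℝ) ≠ 0 := hm'.ne'
  -- the grid `k = ⌈10/ℓ⌉`
  obtain ⟨k, hk_def⟩ : ∃ k : ℕ, k = ⌈10 / mesoRadius (n N)⌉₊ := ⟨_, rfl⟩
  have hkℓ : 10 ≤ (k : ℝ) * mesoRadius (n N) := by
    have h := Nat.le_ceil (10 / mesoRadius (n N))
    rw [← hk_def, div_le_iff₀ hℓ0] at h
    exact h
  have hk0 : 0 < k := by
    rw [hk_def]; exact Nat.ceil_pos.2 (by positivity)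
  have hk' : (0 : ℝ) < k := Nat.cast_pos.2 hk0
  have hk11 : (k : ℝ) ≤ 11 / mesoRadius (n N) := by
    have h := (Nat.ceil_lt_add_one (by positivity : (0 : ℝ) ≤ 10 / mesoRadius (n N))).le
    rw [← hk_def] at h
    have h1 : (1 : ℝ) ≤ 1 / mesoRadius (n N) := by rw [le_div_iff₀ hℓ0]; linarith
    calc (k : ℝ) ≤ 10 / mesoRadius (n N) + 1 := h
      _ ≤ 10 / mesoRadius (n N) + 1 / mesoRadius (n N) := by linarith
      _ = 11 / mesoRadius (n N) := by ring
  have hk2 : mesoRadius (n N) + 2 / k < 1 / 2 := by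
    have h2k : 2 / (k : ℝ) ≤ mesoRadius (n N) / 5 := by rw [div_le_iff₀ hk']; nlinarith
    linarith
  have hk3 : ((k : ℝ) ^ 3) * Real.log (4 * q + 1) ≤ κ / 6 * (n N : ℝ) := by
    have hk3' : (k : ℝ) ^ 3 ≤ 1331 * ((n N : ℝ) * mesoRadius (n N)) := by
      have h1 : (k : ℝ) ^ 3 ≤ (11 / mesoRadius (n N)) ^ 3 := pow_le_pow_left₀ hk'.le hk11 3
      have h2 : (11 / mesoRadius (n N)) ^ 3 = 1331 * ((n N : ℝ) * mesoRadius (n N)) := by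
        have hℓ3 : mesoRadius (n N) ^ 3 * ((n N : ℝ) * mesoRadius (n N)) = 1 := by
          calc mesoRadius (n N) ^ 3 * ((n N : ℝ) * mesoRadius (n N)) = mesoRadius (n N) ^ 4 * (n N : ℝ) := by ring
            _ = 1 := by rw [hℓ4, inv_mul_cancel₀ hmne]
        field_simp
        nlinarith [hℓ3]
      exact h1.trans_eq h2
    calc ((k : ℝ) ^ 3) * Real.log (4 * q + 1) ≤ 1331 * ((n N : ℝ) * mesoRadius (n N)) * Real.log (4 * q + 1) :=
          mul_le_mul_of_nonneg_right hk3' hlog0.le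
      _ = (1331 * Real.log (4 * q + 1) * mesoRadius (n N)) * (n N : ℝ) := by ring
      _ ≤ κ / 6 * (n N : ℝ) := mul_le_mul_of_nonneg_right hcount hm'.le
  -- the core estimate at these data
  have hcore := dn_core hσ hn0 (hε N) hℓ0 hεℓ h13 hmε (fun x => ρ₁ x * Real.exp (g (ρ₁ x))) hρc hM0.le
    (fun x y => (hlip x y).1) hk0 hkℓ hk2 hq0 hγ'0 hγ'C hBρ
  refine hcore.trans ?_
  -- the three numerical factors
  have hCq_le : ENNReal.ofReal (Real.exp (γ' * (n N : ℝ) / (4 * (q : ℝ) ^ 2))) ≤ ENNReal.ofReal (Real.exp (κ / 6 * n N)) := by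
    refine ENNReal.ofReal_le_ofReal (Real.exp_le_exp.2 ?_)
    calc γ' * (n N : ℝ) / (4 * (q : ℝ) ^ 2) = γ' / (4 * (q : ℝ) ^ 2) * n N := by ring
      _ ≤ κ / 6 * n N := mul_le_mul_of_nonneg_right hqκ hm'.le
  have hcard_le : ((((4 * q + 1) ^ (k ^ 3) : ℕ) : ℝ≥0∞)) ≤ ENNReal.ofReal (Real.exp (κ / 6 * n N)) := by
    have hpos : (0 : ℝ) < 4 * q + 1 := by positivity
    have h : (((4 * q + 1) ^ (k ^ 3) : ℕ) : ℝ) ≤ Real.exp (κ / 6 * n N) := by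
      push_cast
      rw [← Real.exp_log (pow_pos hpos (k ^ 3)), Real.exp_le_exp, Real.log_pow]
      push_cast
      exact hk3
    calc (((4 * q + 1) ^ (k ^ 3) : ℕ) : ℝ≥0∞) = ENNReal.ofReal (((4 * q + 1) ^ (k ^ 3) : ℕ) : ℝ) := by
          rw [ENNReal.ofReal_natCast]
      _ ≤ ENNReal.ofReal (Real.exp (κ / 6 * n N)) := ENNReal.ofReal_le_ofReal h
  have hT_le : ENNReal.ofReal (Real.exp ((n N : ℝ) * (2 * γ' * M * mesoRadius (n N) + κ / 6))) ≤
      ENNReal.ofReal (Real.exp (κ / 6 * n N + κ / 6 * n N)) := by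
    refine ENNReal.ofReal_le_ofReal (Real.exp_le_exp.2 ?_)
    have := mul_le_mul_of_nonneg_left hbias hm'.le
    nlinarith
  calc ENNReal.ofReal (Real.exp (γ' * (n N : ℝ) / (4 * (q : ℝ) ^ 2))) *
        ((((4 * q + 1) ^ (k ^ 3) : ℕ) : ℝ≥0∞) * ENNReal.ofReal (Real.exp ((n N : ℝ) * (2 * γ' * M * mesoRadius (n N) + κ / 6))))
      ≤ ENNReal.ofReal (Real.exp (κ / 6 * n N)) * (ENNReal.ofReal (Real.exp (κ / 6 * n N)) *
          ENNReal.ofReal (Real.exp (κ / 6 * n N + κ / 6 * n N))) := by gcongr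
    _ = ENNReal.ofReal (Real.exp (κ / 6 * n N + (κ / 6 * n N + (κ / 6 * n N + κ / 6 * n N)))) := by
        rw [← ENNReal.ofReal_mul (Real.exp_nonneg _), ← ENNReal.ofReal_mul (Real.exp_nonneg _), ← Real.exp_add,
          ← Real.exp_add]
    _ ≤ ENNReal.ofReal (Real.exp (κ * (n N : ℝ))) := by
        refine ENNReal.ofReal_le_ofReal (Real.exp_le_exp.2 ?_)
        nlinarith [hm'.le, hκ.le]

end Summit.AtomisticToContinuum.HydrodynamicLimit.Theorems.NearConstantShortTimeHL

end
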